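import Summits.RiemannHypothesis.RiemannHypothesis.Theorems.TiltedLandingLaw421R3ColumnImmunity

/-! # TiltedLandingLaw421R3ColumnImmunity2 — round 3q SUPPORT: COLUMN IMMUNITY continued (§2c–§4)

SUPPORT module (no stub, no crux, no `sorry`). Nothing here bears on the truth of RH; RH is not proved.

* §2c PURE SHADOW form: `exists_real_ne_zero_near`, `exists_real_ne_zero_ne_zero` (identity theorem on the real axis), ★★★ `columnWindow_of_clearIntervals`
  (an open interval of clear abscissae on each side of `v` inside the column ⇒ `ColumnWindow`), `column_successor_or_ready_of_clearIntervals`; the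
  zero-set predicates `ClearAt`, `ClearGaps`, `BandWindowOrClearGaps` with `windowCaseSig_clearGaps`, `windowCaseSig_bandWindowOrClearGaps` and
  ★★★ `restSuccBotQ_of_theft_noGaps : AntiTheftG BandWindowOrClearGaps → RestSuccBotQ` (theft-only + dirty-chain residual), `restSuccBotQ_of_noGaps`.
* §3 (critic RESULT-21) `ColumnLawQ` DEMOTED (survives the 65-frame scan only via `¬window`; the lineage leaves the column sideways); the door of record
  is the LINEAGE LAW `LineageLawQ` (margin band `MarginBand`), with `stTrkDQ_of_marginBand`, `antiEscape_of_lineageLaw`, `restSuccBotQ_of_lineageLaw`.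
* §4 THE COMBINED RESIDUAL `ResidualQ` (OPEN socket: lowest simple band state, not Ready′, no band window, no clear gaps, no dimple, column empty at
  level `j+1`, all critical points stolen by wing pairs ⇒ successor), `ColumnEmpty`, `thief_in_wing`, `AllStolenWing`, `allStolenWing_of_allStolen`,
  `antiTheftG_of_residualQ`, ★★★ `restSuccBotQ_of_residualQ : ResidualQ → RestSuccBotQ`. -/

namespace RhW08.Column

open Complex Set
open scoped ComplexConjugate
open Literature.Analysis.Complex
open Summit.RiemannHypothesis.RiemannHypothesis.Theorems.Splittings.JensenWindow
open RhIdea6.G17.W07C7 RhIdea6.G17.W07C7.Rev6 RhIdea6.G18.W07C8.Law421BirthS RhIdea6.G19.W07C11.Seam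
open RhIdea6.G20.W07C12.Frac RhIdea6.G20.W07C12.StColP RhW07.C12.FieldSplit RhIdea6.G21.W07C13.TentMax
open RhW07.C14.TwoSided RhW07.C14.Classes RhW07.C14.Lineage RhW07.C14.Booking
open RhW07.C13.Heredity RhIdea6.G22.W07C15pre.Injection RhW07.E3.Cell RhW07.E3.Lit
open RhW08.Round1 RhW08.StSwap RhW08.Round2 RhW08.QuadW RhW08.SealSwapQ RhW08.SealSwap RhW08.SuccB RhW08.SuccSplit

/-! ## §2c Pure SHADOW form: clear INTERVALS suffice (the real zeros of `f^{(j)} f^{(j+1)}` are dodged by the identity theorem) -/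

/-- Identity theorem on the real axis, pointwise form: an entire `G ≢ 0` is non-zero at real points arbitrarily close to any real `x`. -/
theorem exists_real_ne_zero_near {G : ℂ → ℂ} (hG : Differentiable ℂ G) (hne : G ≠ 0) (x : ℝ) {δ : ℝ} (hδ : 0 < δ) :
    ∃ t : ℝ, |t - x| < δ ∧ G t ≠ 0 := by
  rcases (hG.analyticAt (x : ℂ)).eventually_eq_zero_or_eventually_ne_zero with h | h
  · exfalso
    apply hne
    have hA : AnalyticOnNhd ℂ G univ := hG.differentiableOn.analyticOnNhd isOpen_univ
    have h0 := hA.eqOn_zero_of_preconnected_of_eventuallyEq_zero isPreconnected_univ (mem_univ (x : ℂ)) h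
    exact funext fun z => h0 (mem_univ z)
  · rw [eventually_nhdsWithin_iff, Metric.eventually_nhds_iff] at h
    obtain ⟨ε, hε, h⟩ := h
    have hm0 : 0 < min ε δ := lt_min hε hδ
    have hmε : min ε δ ≤ ε := min_le_left _ _
    have hmδ : min ε δ ≤ δ := min_le_right _ _
    refine ⟨x + min ε δ / 2, ?_, h ?_ ?_⟩
    · rw [show x + min ε δ / 2 - x = min ε δ / 2 by ring, abs_of_pos (by linarith)]
      linarith
    · rw [Complex.dist_eq, ← Complex.ofReal_sub, Complex.norm_real, Real.norm_eq_abs,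
        show x + min ε δ / 2 - x = min ε δ / 2 by ring, abs_of_pos (by linarith)]
      linarith
    · simp only [mem_compl_iff, mem_singleton_iff]
      intro heq
      have := Complex.ofReal_injective heq
      linarith

/-- Inside any open real interval there is a point where two entire functions `G, H ≢ 0` are both non-zero. -/
theorem exists_real_ne_zero_ne_zero {G H : ℂ → ℂ} (hG : Differentiable ℂ G) (hGne : G ≠ 0) (hH : Differentiable ℂ H) (hHne : H ≠ 0)
    {p q : ℝ} (hpq : p < q) : ∃ t : ℝ, t ∈ Ioo p q ∧ G t ≠ 0 ∧ H t ≠ 0 := by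
  obtain ⟨t₁, ht₁, hG₁⟩ := exists_real_ne_zero_near hG hGne ((p + q) / 2) (δ := (q - p) / 2) (by linarith)
  have ht₁I : t₁ ∈ Ioo p q := by
    rw [abs_lt] at ht₁
    constructor <;> linarith [ht₁.1, ht₁.2]
  have hopen : IsOpen (G ⁻¹' {0}ᶜ) := hG.continuous.isOpen_preimage _ isOpen_compl_singleton
  obtain ⟨ε₁, hε₁, hball⟩ := Metric.isOpen_iff.mp hopen (t₁ : ℂ) (by simpa using hG₁)
  have hδ0 : 0 < min ε₁ (min (t₁ - p) (q - t₁)) := lt_min hε₁ (lt_min (by linarith [ht₁I.1]) (by linarith [ht₁I.2]))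
  obtain ⟨t, ht, hHt⟩ := exists_real_ne_zero_near hH hHne t₁ hδ0
  have hδε : min ε₁ (min (t₁ - p) (q - t₁)) ≤ ε₁ := min_le_left _ _
  have hδp : min ε₁ (min (t₁ - p) (q - t₁)) ≤ t₁ - p := le_trans (min_le_right _ _) (min_le_left _ _)
  have hδq : min ε₁ (min (t₁ - p) (q - t₁)) ≤ q - t₁ := le_trans (min_le_right _ _) (min_le_right _ _)
  rw [abs_lt] at ht
  refine ⟨t, ⟨by linarith [ht.1], by linarith [ht.2]⟩, ?_, hHt⟩
  have hmem : (t : ℂ) ∈ Metric.ball (t₁ : ℂ) ε₁ := by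
    rw [Metric.mem_ball, Complex.dist_eq, ← Complex.ofReal_sub, Complex.norm_real, Real.norm_eq_abs, abs_lt]
    constructor <;> linarith [ht.1, ht.2]
  simpa using hball hmem

/-- ★★★ PURE SHADOW ENTRY: a band state `v` at level `j`, an open interval of shadow-clear abscissae inside the column on EACH side of `v`
⇒ `ColumnWindow` (the abscissae avoiding the real zeros of `f^{(j)} f^{(j+1)}` are supplied by the identity theorem). Consequently the `¬ColumnWindow`
branch of the STUB-1 residual is EXACTLY: on at least one side of `v`, the closed shadows `[Re a − |Im a|, Re a + |Im a|]` of the non-real zeros of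
`f^{(j)}` COVER the whole stretch of the column between `v`'s shadow and the column edge (a dirty chain to the edge). -/
theorem columnWindow_of_clearIntervals {η : ℝ} {f : ℂ → ℂ} {x₀ s hmax R Hs : ℝ} {B j : ℕ} {v : ℂ}
    (hE : EngineHyps5 2 η f x₀ s hmax R Hs B) (hv : StTrkDQ η f x₀ s hmax R Hs B j v) {p q p' q' : ℝ}
    (hp : x₀ - R / 2 ≤ p) (hpq : p < q) (hq : q ≤ v.re) (hp' : v.re ≤ p') (hpq' : p' < q') (hq' : q' ≤ x₀ + R / 2)
    (hclL : ∀ α ∈ Ioo p q, ∀ a : ℂ, iteratedDeriv j f a = 0 → a.im ≠ 0 → |a.im| ≤ |α - a.re|)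
    (hclR : ∀ β ∈ Ioo p' q', ∀ a : ℂ, iteratedDeriv j f a = 0 → a.im ≠ 0 → |a.im| ≤ |β - a.re|) :
    ColumnWindow f x₀ R j v := by
  have hGd : Differentiable ℂ (iteratedDeriv j f) := differentiable_iteratedDeriv_of_entire hE.1 j
  have hHd : Differentiable ℂ (iteratedDeriv (j + 1) f) := differentiable_iteratedDeriv_of_entire hE.1 (j + 1)
  have hGne : iteratedDeriv j f ≠ 0 := hv.1
  have hHne : iteratedDeriv (j + 1) f ≠ 0 := iteratedDeriv_succ_ne_zero_of_zero hE.1 j hv.1 hv.2.1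
  obtain ⟨α, hαI, hGα, hHα⟩ := exists_real_ne_zero_ne_zero hGd hGne hHd hHne hpq
  obtain ⟨β, hβI, hGβ, hHβ⟩ := exists_real_ne_zero_ne_zero hGd hGne hHd hHne hpq'
  exact columnWindow_of_clear hE hv (by linarith [hαI.1]) (by linarith [hαI.2]) (by linarith [hβI.1]) (by linarith [hβI.2])
    (hclL α hαI) (hclR β hβI) hGα hGβ hHα hHβ

/-- ★★★ … and the column step from clear intervals: successor band state, or an NL event of level `j` inside the column. -/
theorem column_successor_or_ready_of_clearIntervals {η : ℝ} {f : ℂ → ℂ} {x₀ s hmax R Hs : ℝ} {B j : ℕ} {v : ℂ}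
    (hE : EngineHyps5 2 η f x₀ s hmax R Hs B) (hv : StTrkDQ η f x₀ s hmax R Hs B j v) {p q p' q' : ℝ}
    (hp : x₀ - R / 2 ≤ p) (hpq : p < q) (hq : q ≤ v.re) (hp' : v.re ≤ p') (hpq' : p' < q') (hq' : q' ≤ x₀ + R / 2)
    (hclL : ∀ α ∈ Ioo p q, ∀ a : ℂ, iteratedDeriv j f a = 0 → a.im ≠ 0 → |a.im| ≤ |α - a.re|)
    (hclR : ∀ β ∈ Ioo p' q', ∀ a : ℂ, iteratedDeriv j f a = 0 → a.im ≠ 0 → |a.im| ≤ |β - a.re|) (u : ℂ) :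
    (∃ w : ℂ, StTrkDQ η f x₀ s hmax R Hs B (j + 1) w) ∨ RhW08.StSwap.ReadyR2 η f x₀ s hmax R Hs B j u := by
  by_cases hempty : ∀ u' : ℂ, ¬ StTrkDQ η f x₀ s hmax R Hs B (j + 1) u'
  · exact Or.inr (readyR2_of_columnWindow_noSucc hE hv hempty
      (columnWindow_of_clearIntervals hE hv hp hpq hq hp' hpq' hq' hclL hclR) u)
  · push Not at hempty
    exact Or.inl hempty

/-- `α` is a CLEAR ABSCISSA at level `j`: outside the open shadow of every non-real zero of `f^{(j)}` (pure zero-set data). -/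
def ClearAt (f : ℂ → ℂ) (j : ℕ) (α : ℝ) : Prop :=
  ∀ a : ℂ, iteratedDeriv j f a = 0 → a.im ≠ 0 → |a.im| ≤ |α - a.re|

/-- CLEAR GAPS around `v` inside the column: an open interval of clear abscissae on each side of `Re v`, within `[x₀ − R/2, x₀ + R/2]`
(pure zero-set data; the shape `(f x₀ R Hs j v)` of the window-generic assembly, `Hs` unused). -/
def ClearGaps (f : ℂ → ℂ) (x₀ R _Hs : ℝ) (j : ℕ) (v : ℂ) : Prop :=
  (∃ p q : ℝ, x₀ - R / 2 ≤ p ∧ p < q ∧ q ≤ v.re ∧ ∀ α ∈ Ioo p q, ClearAt f j α) ∧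
  (∃ p' q' : ℝ, v.re ≤ p' ∧ p' < q' ∧ q' ≤ x₀ + R / 2 ∧ ∀ β ∈ Ioo p' q', ClearAt f j β)

/-- Clear gaps on both sides of `Re v` give a column window. -/
theorem columnWindow_of_clearGaps {η : ℝ} {f : ℂ → ℂ} {x₀ s hmax R Hs : ℝ} {B j : ℕ} {v : ℂ}
    (hE : EngineHyps5 2 η f x₀ s hmax R Hs B) (hv : StTrkDQ η f x₀ s hmax R Hs B j v) (hC : ClearGaps f x₀ R Hs j v) :
    ColumnWindow f x₀ R j v := by
  obtain ⟨⟨p, q, hp, hpq, hq, hclL⟩, ⟨p', q', hp', hpq', hq', hclR⟩⟩ := hC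
  exact columnWindow_of_clearIntervals hE hv hp hpq hq hp' hpq' hq' hclL hclR

/-- `ClearGaps` satisfies `WindowCaseSig`. -/
theorem windowCaseSig_clearGaps : WindowCaseSig ClearGaps := by
  intro η f x₀ s hmax R Hs B hE j v hv hempty hC
  exact readyR2_of_columnWindow_noSucc hE hv hempty (columnWindow_of_clearGaps hE hv hC) v

/-- EITHER the tree's all-in-band in-range window OR clear gaps in the column (pure zero-set data). -/
def BandWindowOrClearGaps (f : ℂ → ℂ) (x₀ R Hs : ℝ) (j : ℕ) (v : ℂ) : Prop :=
  AllInBandInRangeWindow f x₀ R Hs j v ∨ ClearGaps f x₀ R Hs j v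

/-- `BandWindowOrClearGaps` satisfies `WindowCaseSig` (union of two window cases). -/
theorem windowCaseSig_bandWindowOrClearGaps : WindowCaseSig BandWindowOrClearGaps := by
  intro η f x₀ s hmax R Hs B hE j v hv hempty hW
  rcases hW with hW | hC
  · exact windowCaseSig_allInBand η f x₀ s hmax R Hs B hE j v hv hempty hW
  · exact windowCaseSig_clearGaps η f x₀ s hmax R Hs B hE j v hv hempty hC

/-- ★★★ STUB 1 from THEFT-ONLY + DIRTY-CHAIN residual: `AntiTheftG BandWindowOrClearGaps → RestSuccBotQ`. In words, the residual may assume: legal frame,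
lowest band state `v` simple, level not Ready′, no all-in-band in-range window, NO CLEAR GAP on at least one side of `v` inside the column (the closed
shadows of the non-real zeros of `f^{(j)}` cover that whole stretch), no dimple at `v`, and every upper zero of `f^{(j+1)}` off `Z(f^{(j)})` strictly
inside the disc of an out-of-band pair — and must produce a level-`(j+1)` band state. -/
theorem restSuccBotQ_of_theft_noGaps (hT : RhW08.SuccTheft.AntiTheftG BandWindowOrClearGaps) : RestSuccBotQ :=
  RhW08.SuccTheft.restSuccBotQ_of_theftG windowCaseSig_bandWindowOrClearGaps dimpleSig_holds hT

/-- ★ STUB 1 from the ANTI-ESCAPE residual without gaps: `AntiEscapeG BandWindowOrClearGaps → RestSuccBotQ`. -/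
theorem restSuccBotQ_of_noGaps (hA : AntiEscapeG BandWindowOrClearGaps) : RestSuccBotQ :=
  restSuccBotQ_of_piecesG windowCaseSig_bandWindowOrClearGaps dimpleSig_holds hA

/-- EITHER window: the tree's all-in-band in-range window OR a column window. -/
def AnyWindow (f : ℂ → ℂ) (x₀ R Hs : ℝ) (j : ℕ) (v : ℂ) : Prop :=
  AllInBandInRangeWindow f x₀ R Hs j v ∨ ColumnWindow f x₀ R j v

/-- `AnyWindow` (either in-band or column) satisfies `WindowCaseSig`. -/
theorem windowCaseSig_anyWindow : WindowCaseSig AnyWindow := by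
  intro η f x₀ s hmax R Hs B hE j v hv hempty hW
  rcases hW with hW | hW
  · exact windowCaseSig_allInBand η f x₀ s hmax R Hs B hE j v hv hempty hW
  · exact readyR2_of_columnWindow_noSucc hE hv hempty hW v

/-- ★★ STUB 1 from the SMALLEST window residual so far: `AntiEscapeG AnyWindow → RestSuccBotQ` — the anti-escape residual may assume that around the lowest
band state there is NEITHER an all-in-band in-range Jensen window NOR a Jensen window fitting inside the column. -/
theorem restSuccBotQ_of_noAnyWindow (hA : AntiEscapeG AnyWindow) : RestSuccBotQ :=
  restSuccBotQ_of_piecesG windowCaseSig_anyWindow dimpleSig_holds hA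

/-- ★★★ The SMALLEST typed residual of STUB 1 to date: THEFT-ONLY (tree `…R3SuccTheft`: every upper critical point off `Z(F_j)` strictly inside the disc of an
OUT-of-band pair) AND no dimple AND neither window (all-in-band in-range, or inside the column) ⇒ a successor. `AntiTheftG AnyWindow → RestSuccBotQ`. -/
theorem restSuccBotQ_of_theft_noAnyWindow (hT : RhW08.SuccTheft.AntiTheftG AnyWindow) : RestSuccBotQ :=
  RhW08.SuccTheft.restSuccBotQ_of_theftG windowCaseSig_anyWindow dimpleSig_holds hT

/-! ## §3 The LINEAGE LAW (critic RESULT-21 (2)): a band state WITH LATERAL MARGIN `R/2` at every non-Ready′ level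

Critic RESULT-21 (65-frame scan, mirrors `g21/own/nse/colaw4.json`, `colaw5.json`): `ColumnLawQ` has 0 counterexamples but survives ONLY through its
`¬AllInBandInRangeWindow` hypothesis — the w₀-lineage LEAVES THE COLUMN SIDEWAYS without landing (colaw4: +0.125/level, column empty from level 9, first
Ready′ level 13), so «upper zero in the column» is not a proof route; `ColumnLawQ` is hereby DEMOTED to the regime `j ≤ R/(2σ_max)` / kept only as a typed
socket. The provable-looking lineage statement is (E3): the nested w₀-chain is a band state with lateral MARGIN `R/2`. Typed here as `LineageLawQ`, with
its kernel consequence `LineageLawQ → AntiEscape → RestSuccBotQ`. OPEN; census 0/183 + 0/65 (critic). -/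

/-- MARGIN band at level `j+1`: `(|Re u − x₀| + R/2)² + (j+1)·(Im u)² ≤ (j+1)·Hs²` (critic (E3): `(ρ(u) + R/2)² ≤ (j+1)(Hs² − Im u²)`). It implies the
level-`(j+1)` band inequality with room: the state stays in band under any lateral displacement by `≤ R`. -/
def MarginBand (x₀ R Hs : ℝ) (j : ℕ) (u : ℂ) : Prop :=
  (|u.re - x₀| + R / 2) ^ 2 + ((j : ℝ) + 1) * u.im ^ 2 ≤ ((j : ℝ) + 1) * Hs ^ 2

/-- ★ LINEAGE LAW (OPEN socket; critic RESULT-21 (2) / RESULT-20 (E3)): on a legal frame, at every level `j` (with `f^{(j)} ≢ 0`) that is not Ready′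
(cumulatively: `¬ReadyR2`), `f^{(j+1)}` has an upper zero in the MARGIN band. Mechanism of record: the w₀-lineage (nested chain from the budget pair
`w₀`, `Re w₀ = x₀`) keeps `MarginBand` under nested steps ((E2) with excess `e ≤ 0`); the open content is the chain's THEFT steps. -/
def LineageLawQ : Prop :=
  ∀ (η : ℝ) (f : ℂ → ℂ) (x₀ s hmax R Hs : ℝ) (B : ℕ), EngineHyps5 2 η f x₀ s hmax R Hs B → ∀ (j : ℕ) (v : ℂ),
    iteratedDeriv j f ≠ 0 → ¬ ReadyR2 η f x₀ s hmax R Hs B j v →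
    ∃ u : ℂ, iteratedDeriv (j + 1) f u = 0 ∧ 0 < u.im ∧ MarginBand x₀ R Hs j u

/-- A margin-band upper zero of `f^{(j+1)} ≢ 0` is a level-`(j+1)` band state. -/
theorem stTrkDQ_of_marginBand {η : ℝ} {f : ℂ → ℂ} {x₀ s hmax R Hs : ℝ} {B j : ℕ} (hE : EngineHyps5 2 η f x₀ s hmax R Hs B)
    (hnz : iteratedDeriv (j + 1) f ≠ 0) {u : ℂ} (hu : iteratedDeriv (j + 1) f u = 0) (hup : 0 < u.im) (hm : MarginBand x₀ R Hs j u) :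
    StTrkDQ η f x₀ s hmax R Hs B (j + 1) u := by
  unfold MarginBand at hm
  have hR : 0 < R := by
    have h1 : 0 < s := hE.2.2.2.1
    have h2 : 2 * s ≤ hmax := hE.2.2.2.2.1
    have h3 : 3 * hmax < R := hE.2.2.2.2.2.2.1
    linarith
  have hHs : 0 ≤ Hs := hE.2.2.2.2.2.2.2.1
  have ha : 0 ≤ |u.re - x₀| := abs_nonneg _
  have hsq : 0 ≤ (|u.re - x₀| + R / 2) ^ 2 := sq_nonneg _
  have hj : (0 : ℝ) < (j : ℝ) + 1 := by positivity
  have him2 : u.im ^ 2 ≤ Hs ^ 2 := by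
    by_contra hlt
    push Not at hlt
    nlinarith [mul_lt_mul_of_pos_left hlt hj]
  have him : u.im ≤ Hs := by nlinarith [him2, hup, hHs]
  refine ⟨hnz, hu, hup, ?_, him⟩
  push_cast
  have hmx0 : 0 ≤ max (|u.re - x₀| - R / 2) 0 := le_max_right _ _
  have hmx : max (|u.re - x₀| - R / 2) 0 ≤ |u.re - x₀| + R / 2 := max_le (by linarith) (by linarith)
  have hp : (max (|u.re - x₀| - R / 2) 0) ^ 2 ≤ (|u.re - x₀| + R / 2) ^ 2 := pow_le_pow_left₀ hmx0 hmx 2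
  linarith

/-- ★ `LineageLawQ → AntiEscape` (the margin-band zero is the successor; the window/dimple hypotheses of `AntiEscape` are not even used). -/
theorem antiEscape_of_lineageLaw (h : LineageLawQ) : AntiEscape := by
  intro η f x₀ s hmax R Hs B hE j v hlow hnr _ _
  obtain ⟨u, hu, hup, hm⟩ := h η f x₀ s hmax R Hs B hE j v hlow.1.1 hnr
  exact ⟨u, stTrkDQ_of_marginBand hE (iteratedDeriv_succ_ne_zero_of_zero hE.1 j hlow.1.1 hlow.1.2.1) hu hup hm⟩

/-- ★ STUB 1 from the lineage law: `LineageLawQ → RestSuccBotQ`. -/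
theorem restSuccBotQ_of_lineageLaw (h : LineageLawQ) : RestSuccBotQ :=
  restSuccBotQ_of_antiEscape (antiEscape_of_lineageLaw h)

/-! ## §4 The COMBINED residual of STUB 1 (everything this file and the tree's `…R3SuccTheft` cut away, in one socket) -/

/-- COLUMN EMPTY at level `j+1`: `f^{(j+1)}` has no upper zero in the column (else it is a successor, by column immunity). -/
def ColumnEmpty (f : ℂ → ℂ) (x₀ R : ℝ) (j : ℕ) : Prop :=
  ∀ w : ℂ, iteratedDeriv (j + 1) f w = 0 → 0 < w.im → R / 2 < |w.re - x₀|

/-- A THIEF (an out-of-band upper zero of `f^{(j)}`) lives in the WINGS: by column immunity every upper zero in the column is a band state. -/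
theorem thief_in_wing {η : ℝ} {f : ℂ → ℂ} {x₀ s hmax R Hs : ℝ} {B j : ℕ} {a : ℂ} (hE : EngineHyps5 2 η f x₀ s hmax R Hs B)
    (hnz : iteratedDeriv j f ≠ 0) (ha : iteratedDeriv j f a = 0) (hapos : 0 < a.im) (hna : ¬ StTrkDQ η f x₀ s hmax R Hs B j a) :
    R / 2 < |a.re - x₀| := by
  by_contra h
  push Not at h
  exact hna (stTrkDQ_of_column hE hnz ha hapos h)

/-- `AllStolen` with the thieves located in the wings. -/
def AllStolenWing (η : ℝ) (f : ℂ → ℂ) (x₀ s hmax R Hs : ℝ) (B j : ℕ) (v : ℂ) : Prop :=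
  ∀ w : ℂ, iteratedDeriv (j + 1) f w = 0 → 0 < w.im → iteratedDeriv j f w ≠ 0 →
    ∃ a : ℂ, iteratedDeriv j f a = 0 ∧ 0 < a.im ∧ a ≠ v ∧ ‖w - a.re‖ < a.im ∧ ¬ StTrkDQ η f x₀ s hmax R Hs B j a ∧ R / 2 < |a.re - x₀|

/-- `AllStolen` implies `AllStolenWing`: thieves live in the wings by column immunity. -/
theorem allStolenWing_of_allStolen {η : ℝ} {f : ℂ → ℂ} {x₀ s hmax R Hs : ℝ} {B j : ℕ} {v : ℂ} (hE : EngineHyps5 2 η f x₀ s hmax R Hs B)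
    (hnz : iteratedDeriv j f ≠ 0) (hAS : RhW08.SuccTheft.AllStolen η f x₀ s hmax R Hs B j v) :
    AllStolenWing η f x₀ s hmax R Hs B j v := by
  intro w hw hwpos hGw
  obtain ⟨a, ha, hapos, hav, hdisc, hna⟩ := hAS w hw hwpos hGw
  exact ⟨a, ha, hapos, hav, hdisc, hna, thief_in_wing hE hnz ha hapos hna⟩

/-- ★★★ THE COMBINED RESIDUAL (OPEN socket): legal frame; `v` the lowest band state of level `j`, simple; level not Ready′; no all-in-band in-range
window; NO CLEAR GAPS around `v` in the column (dirty chain); no dimple at `v`; the column is EMPTY at level `j+1`; every upper critical point off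
`Z(f^{(j)})` is stolen by an out-of-band pair IN THE WINGS ⇒ a level-`(j+1)` band state. Every clause is decidable from the zero sets of `f^{(j)}`,
`f^{(j+1)}` (plus NL events on the base for Ready′). -/
def ResidualQ : Prop :=
  ∀ (η : ℝ) (f : ℂ → ℂ) (x₀ s hmax R Hs : ℝ) (B : ℕ), EngineHyps5 2 η f x₀ s hmax R Hs B → ∀ (j : ℕ) (v : ℂ),
    IsLowest StTrkDQ η f x₀ s hmax R Hs B j v → ¬ ReadyR2 η f x₀ s hmax R Hs B j v →
    ¬ AllInBandInRangeWindow f x₀ R Hs j v → ¬ ClearGaps f x₀ R Hs j v → ¬ Dimple f j v →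
    iteratedDeriv (j + 1) f v ≠ 0 → ColumnEmpty f x₀ R j → AllStolenWing η f x₀ s hmax R Hs B j v →
    ∃ u : ℂ, StTrkDQ η f x₀ s hmax R Hs B (j + 1) u

/-- `ResidualQ` implies `AntiTheftG BandWindowOrClearGaps`. -/
theorem antiTheftG_of_residualQ (h : ResidualQ) : RhW08.SuccTheft.AntiTheftG BandWindowOrClearGaps := by
  intro η f x₀ s hmax R Hs B hE j v hlow hnr hnW hnd hsimple hAS
  have hnW' : ¬ AllInBandInRangeWindow f x₀ R Hs j v ∧ ¬ ClearGaps f x₀ R Hs j v := not_or.mp hnW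
  by_cases hCE : ColumnEmpty f x₀ R j
  · exact h η f x₀ s hmax R Hs B hE j v hlow hnr hnW'.1 hnW'.2 hnd hsimple hCE (allStolenWing_of_allStolen hE hlow.1.1 hAS)
  · unfold ColumnEmpty at hCE
    push Not at hCE
    obtain ⟨w, hw, hwpos, hcol⟩ := hCE
    exact ⟨w, stTrkDQ_succ_of_column hE hlow.1 hw hwpos hcol⟩

/-- ★★★ STUB 1 from the combined residual. -/
theorem restSuccBotQ_of_residualQ (h : ResidualQ) : RestSuccBotQ :=
  restSuccBotQ_of_theft_noGaps (antiTheftG_of_residualQ h)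

end RhW08.Column
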